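import Summits.QuantumFields.YangMills.Theorems.UnitScaleTiltHalvingP1FlatCoreTopStepTorus
import Literature.MathematicalPhysics.QuantumFieldTheory.Balaban1983to89.B8SockHFPRD
import Literature.MathematicalPhysics.QuantumFieldTheory.Balaban1983to89.B8Eq191FlatStencils
import HarnessLib

/-!
# `hP1room` PROGRAMME (LEAD-H BOARD v3, «w7-19200: (O1) GO» 2026-08-28T16:39Z), (A-1) STAGE 3b BASE: ★★★ THE TOP-STEP CALL FOR THE `K − n = 1` MEMBER —
# ✓`P1FlatCoreTopStepTorus.hFP_kLevel_top_RD` (✓p636261) AT `k = 1` WITH NO LOWER DATUM (`u₁ := 1`, `U₁ := U′`, the chart one-form `A` of `U′` itself)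

Route `UnitScaleTilt`, crux K1 child «MinimiserStabilityRegPr» (stmt-QuantumFields-19200), registered stub `stub_halvingStep` (`BirthV10`), text `hP1room ⟸ hSupU(ρ2)`
(✓p641613 ∘ ✓p640588; per site ✓p643656 `HalvingP1FlatCoreSupplierDoor.hSup_of_contentRows`, knit ✓p646003 ∘ ✓p647313 from the top-step call's OUTPUT rows).
Cell `ym3-torus` (HUMAN RULING D-0037: YM₃ on T³ is ladder rung R3 — NOT d = 4, NOT a mass gap, NOT the Clay problem), width seat `ym-ust-19200-w7` gen 5.
`--supports stmt-QuantumFields-19200 --as helper`; THEOREMS ONLY (0 `def`, 0 `sorry`); count-neutral; nothing here claims `core′`, `hP1room`, `hSupU`, the stub, the crux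
or the gap.

WHY.  ✓`HalvingP1FlatCoreSupplierTopCall.topRows_of_datum` (✓p646092, FILE B) reads Proposition 5 at `m + 1 ≥ 2` levels from Theorem 4's inductive datum `(u₁, U₁, A)`
at level `m ≥ 1` (`hm1 : 1 ≤ m`: its source row `D*A′` is Proposition 3 at level `m` through the b9 socket, and its lower family (C) is FILE A's).  The member with
`K − n = 1` has NO lower datum: Theorem 4's induction starts there ([Balaban1985RegularSpaces] p. 88 «for k = 1 … Theorem 2»), the datum is the pre-gauged field
`U′` itself with the chart one-form `A = (iη)⁻¹ log U′` ((1.36)∕(1.69) at the base, ✓`HalvingP1FlatCoreSupplierPreGauge` §1∕§2), and the family below the top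
is the level-`0` piece `C′₀(u, μ) = log(e^{μ}·u·u⁻¹) − Q′₀μ = 0` IDENTICALLY (`Q′₀ = id`, `R̄⁰ = id`).
WHAT.  ★★★ `topRows_of_preGauge_base` — FILE B's statement with `m + 1 ↦ 1` and ONE restriction structure `Λs1` (= `cubeLamS L a M′ ρ′ 1 1` at the cube member),
the datum block `(u₁ U₁ hu₁ hW h129 hLan hdat)`, the b9 socket, Proposition 3's and the JOIN's scalar windows and `hbox hclass hlt htop` DROPPED (they fed
`grad_bound_of_datum`∕FILE A only), and in their place THE BASE DATUM: a Hermitian one-form `A` with `U′ = e^{iηA}` and `η‖A‖ ≤ 2s` on both bonds `(x, μ)`,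
`(x − e_μ, μ)` at every `x ∈ Ω₀` (for the J3 instance: ✓p645784 `exists_preGauge_chart`'s □₀ rows of the cutoff one-form, `s = 22d²ε₀ + 4·l1(□̃)·ε₀`), plus the two
windows `L·(2s) ≤ cA`, `4d·L²·s ≤ cDA` it turns into ✓p636261's `hA`∕`hDA` (`|A|`, `|D*A|₍₋₂₎` at levels `j ≤ 1`; crude difference quotient, no Proposition 3).
The [4] letters at `(1, U₀ := 1)`, the torus blocks (D)(E) and the top-step windows are ✓p636261's VERBATIM at `k := 1`; the (C) rows at `j < 1` are discharged here
(`Cnl_level_zero`).  OUTPUT = FILE B's SEVEN conjuncts VERBATIM at `m + 1 := 1`, `Λs (m+1) := Λs1`, `u₁ := 1` — so ✓p646003 `doorRows_of_topRows` and ✓p647313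
`hSupBlock_of_topRows` (`u₁ := 1`, `W := U′`, `hW : mgauge 1 1 U′ = U′`, `hchart₀`∕`hchartTop` := ✓p645784's rows) consume it unchanged at `K − n = 1`.
HONEST SCOPE.  By-name plumbing + two triangle inequalities; every analytic row (the [4] letters and bounds, the torus blocks (D)(E), the top windows) stays DISPLAYED;
nothing of Proposition 5, Theorem 4, `core′` or the stub is proved here; the τ-sibling (traceless `λ′`, ✓`hFP_kLevel_top_RD_traceFree`) is the next file.

References: T. Bałaban, CMP **99** (1985) 75–102 [Balaban1985RegularSpaces] (Prop. 5 (1.106)–(1.109) p.94, Thm 4 p.88 («for k = 1»), (1.36) p.82, (1.66)–(1.69) p.88,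
(1.112)–(1.125) pp.95–97); CMP **99** (1985) 389–434 [Balaban1985BackgroundPropagators] (Thm 3.1 p.397, (3.25) p.394); CMP **98** (1985) 17–51 [Balaban1985Averaging]
((178)–(179) p.45, (208)–(214) p.50).
-/

set_option autoImplicit false

noncomputable section

open scoped BigOperators
open NormedSpace
open Complex (I)

namespace Summit.QuantumFields.YangMills.Theorems.HalvingP1FlatCoreSupplierTopCallBase

open Literature.MathematicalPhysics.QuantumFieldTheory.Balaban1983to89
open T4Continuum
open MatrixLog (mlog)
open B7Prop1Explicit (e expUnit val_expUnit U1)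
open B7Prop2Explicit (unitaryUnits)
open B7Prop1Local (InBox)
open B7Eq78Linearization (conjR conjR_apply zdBlocking QprimeIter QprimeIter_zero Rbar_zero)
open B7Eq170Flat (cj mlog_exp_of_le)
open B8Ineq130 (tlo thi tlo_apply thi_apply)
open B8Ineq132 (covDerivFwd covDeriv)
open B8Eq119TwistedAxial (bgT)
open B8Eq184Proof (gaugeExp cfgExp)
open B8Eq182Proof (gAd)
open B8Eq188Proof (frakF3)
open B8Eq140Level (SideTouches)
open B8Eq138LandauZd (covDivB covLap QT)
open B8Eq1117Concrete (XSpace)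
open B8Prop5ContractionKLevel (Bd2 Mc Kc)
open B8LambdaSpaceKLevel (wt)
open B8Eq178Averages (Qnl util178)
open B8Eq1123Concrete (Cnl)
open B8Eq191FlatStencils (conjR_unitOne_inv)
open B8Prop5SocketDatum (sideTouches_pair_of_mem sideTouches_of_tower_bond)
open B8SockHFPAssembly (isSelfAdjoint_covDivB)
open B10Eq27TorusAxialLog (axialT)
open Node00 (coverAt)
open B15Eq112TorusCover (cover)
open LatticeFieldCalculus (siteAvgIter)
open Summit.QuantumFields.YangMills.Theorems.Prop8ChartDoubleBar (dbarIterU)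
open Summit.QuantumFields.YangMills.Theorems.P1FlatCoreTopStepTorus (hFP_kLevel_top_RD)

-- `Site` alone could resolve to the torus sites; N05's carriers are `Fin d → ℤ`.
open B7Prop1Explicit (Site)

/-! ## §1 The level-`0` piece of the Sect. E family is identically zero -/

section LevelZero

variable {d : ℕ} {𝔸 : Type*} [NormedRing 𝔸] [NormedAlgebra ℂ 𝔸] [CompleteSpace 𝔸]

/-- **`C′₀(u, μ) = 0`**: at level `0` there is no averaging (`R̄⁰ = id`, `Q′₀ = id`, [Balaban1985BackgroundPropagators] (3.19) «`Q′₀ = id`»), so `ũ′⁰ = e^{μ}·u·u⁻¹ = e^{μ}` and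
`C′₀(u, μ)(y) = log e^{μ(y)} − μ(y) = 0` for `‖μ(y)‖ ≤ 1∕5`. [cite: Balaban1985RegularSpaces, (1.112) p.95, (1.78) p.90; Balaban1985BackgroundPropagators, (3.19) p.393] -/
theorem Cnl_level_zero (L : ℕ) (U₀ : Site d → Fin d → 𝔸ˣ) (u : Site d → 𝔸ˣ) (μ : Site d → 𝔸) (y : Site d) (hμ : ‖μ y‖ ≤ 1 / 5) :
    Cnl L U₀ u 0 μ y = 0 := by
  rw [Cnl, Qnl, util178, Rbar_zero, Rbar_zero, QprimeIter_zero, Pi.mul_apply, Units.val_mul, Ring.inverse_unit, val_expUnit, mul_assoc,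
    Units.mul_inv, mul_one, mlog_exp_of_le hμ, sub_self]

/-- the one-site box at level `0`: `[tlo y 0, thi y 0] = {y}` contains `y`. [folklore] -/
theorem inBox_tlo_thi_zero_self (L : ℕ) (y : Site d) : InBox (tlo L y 0) (thi L y 0) y := by
  intro i
  rw [tlo_apply, thi_apply, pow_zero, one_mul, one_mul, add_sub_cancel_right]
  exact ⟨le_rfl, le_rfl⟩

end LevelZero

/-! ## §2 ★★★ The top-step call at the base -/

variable {P : Params} {𝔸 : Type*} [CStarAlgebra 𝔸] [Nontrivial 𝔸]

/-- ★★★ **THE TOP-STEP CALL FOR THE `K − n = 1` MEMBER** (the base twin of ✓`HalvingP1FlatCoreSupplierTopCall.topRows_of_datum`).  See the module docstring: FILE B's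
binders with `m + 1 ↦ 1`, the datum∕b9∕Prop-3∕JOIN blocks replaced by the BASE DATUM (`A` Hermitian, `U′ = e^{iηA}` and `η‖A‖ ≤ 2s` on the stars of `Ω₀`) and its two
windows; [4] letters, torus blocks (D)(E) and top windows VERBATIM at `k := 1`; OUTPUT = FILE B's seven conjuncts at `m + 1 := 1`, `u₁ := 1`.
[cite: Balaban1985RegularSpaces, Prop. 5 (1.106)-(1.109) p.94, Thm 4 p.88, (1.36) p.82, (1.66)-(1.69) p.88, (1.112)-(1.125) pp.95-97; Balaban1985BackgroundPropagators, Thm 3.1 p.397, (3.25) p.394; Balaban1985Averaging, (208)-(214) p.50] -/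
theorem topRows_of_preGauge_base (hd2 : 2 ≤ P.d) (hL : 2 ≤ P.L) {η : ℝ} (hη : 0 < η) (h1P : 1 ≤ P.m + P.K)
    -- the member's geometry: nested regions, the ONE restriction structure of the `k = 1` member, its tower inside the regions
    {Ω : ℕ → Set (Site P.d)} (hΩ : ∀ j, Ω (j + 1) ⊆ Ω j) {Λs1 : ℕ → Set (Site P.d)}
    (htower : ∀ j, j ≤ 1 → ∀ y ∈ Λs1 j, ∀ x, InBox (tlo P.L y j) (thi P.L y j) x → x ∈ Ω j)
    -- THE BASE DATUM: the pre-gauged field `U′` IS `e^{iηA}` with `A` Hermitian, `η‖A‖ ≤ 2s`, on both bonds `(x, μ)`, `(x − e_μ, μ)` at every `x ∈ Ω₀` (✓p645784's rows)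
    {U' : Site P.d → Fin P.d → 𝔸ˣ} {A : Site P.d → Fin P.d → 𝔸} (hAsa : ∀ x μ, IsSelfAdjoint (A x μ)) {s : ℝ} (hs : 0 ≤ s)
    (hArows : ∀ x ∈ Ω 0, ∀ μ : Fin P.d,
      (U' x μ = cfgExp η A x μ ∧ η * ‖A x μ‖ ≤ 2 * s) ∧ (U' (x - e μ) μ = cfgExp η A (x - e μ) μ ∧ η * ‖A (x - e μ) μ‖ ≤ 2 * s))
    -- its two windows (the source rows `hA`∕`hDA` of ✓p636261 at levels `j ≤ 1`) and the JOIN's `cA ≤ 1∕13`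
    {α₄ cA cDA : ℝ} (hα₄ : 0 < α₄) (hcAw : (P.L : ℝ) * (2 * s) ≤ cA) (hcDAw : 4 * (P.d : ℝ) * (P.L : ℝ) ^ 2 * s ≤ cDA) (hcA' : cA ≤ 1 / 13)
    -- the [4] LETTERS at `(1, U₀ := 1)`, displayed as the top step reads them (✓`topRows_of_datum`'s block at `m + 1 := 1`)
    (g Δ : (Site P.d → 𝔸) →ₗ[ℂ] (Site P.d → 𝔸)) (q : (Site P.d → 𝔸) →ₗ[ℂ] (ℕ → Site P.d → 𝔸)) (qs : (ℕ → Site P.d → 𝔸) →ₗ[ℂ] (Site P.d → 𝔸))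
    (Aw c : (ℕ → Site P.d → 𝔸) →ₗ[ℂ] (ℕ → Site P.d → 𝔸))
    (g_rightΩ : ∀ x, ∀ y ∈ Ω 0, (Δ (g x) + qs (Aw (q (g x)))) y = x y)
    (c_range : ∀ f, q (g (g (qs (c (q f))))) = q f)
    (hΔ : ∀ (f : Site P.d → 𝔸), ∀ x ∈ Ω 0, Δ f x = covLap η (1 : Site P.d → Fin P.d → 𝔸ˣ) ((Ω 0).indicator f) x)
    (hqs : ∀ (μ : ℕ → Site P.d → 𝔸), ∀ x ∈ Ω 0, qs μ x = QT P.L 1 Λs1 (1 : Site P.d → Fin P.d → 𝔸ˣ) μ x)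
    (hq : ∀ (f : Site P.d → 𝔸) (j : ℕ), j ≤ 1 → ∀ y ∈ Λs1 j,
      q f j y = QprimeIter (zdBlocking P.d P.L) (bgT P.L (1 : Site P.d → Fin P.d → 𝔸ˣ)) j f y)
    (H' : XSpace P.d 1 𝔸 →ₗ[ℂ] (Site P.d → 𝔸)) {B₀'H B₂' BG BR : ℝ} (hB₀'H : 0 < B₀'H) (hB₂' : 0 ≤ B₂') (hBG : 0 ≤ BG) (hBR : 0 ≤ BR)
    (hH0 : ∀ (X : XSpace P.d 1 𝔸) (x : Site P.d), ‖H' X x‖ ≤ B₀'H * ‖X‖)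
    (hH1 : ∀ j, j ≤ 1 → ∀ (X : XSpace P.d 1 𝔸), ∀ p ∈ {b : Site P.d × Fin P.d | SideTouches (Ω j) b.1 b.2},
      wt P.L η j * ‖covDerivFwd η (1 : Site P.d → Fin P.d → 𝔸ˣ) p.2 (H' X) p.1‖ ≤ B₀'H * ‖X‖)
    (hH2 : ∀ X : XSpace P.d 1 𝔸, Bd2 P.L η 1 Ω (covLap η (1 : Site P.d → Fin P.d → 𝔸ˣ) (H' X)) (B₂' * ‖X‖))
    (hHsupp : ∀ (X : XSpace P.d 1 𝔸) (x : Site P.d), x ∉ Ω 0 → H' X x = 0)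
    (hHequiv : ∀ X Y : XSpace P.d 1 𝔸, (∀ p, Y p = -star (X p)) → ∀ x, H' Y x = -star (H' X x))
    (hQH : ∀ (Y : XSpace P.d 1 𝔸) (j : ℕ) (hj : j ≤ 1) (y : Site P.d), y ∈ Λs1 j →
      QprimeIter (zdBlocking P.d P.L) (bgT P.L (1 : Site P.d → Fin P.d → 𝔸ˣ)) j (H' Y) y = Y (⟨j, Nat.lt_succ_of_le hj⟩, y))
    (hG : ∀ (f : Site P.d → 𝔸) (r : ℝ), 0 ≤ r → Bd2 P.L η 1 Ω f r →
      (∀ x, ‖g f x‖ ≤ BG * r) ∧ ∀ j, j ≤ 1 → ∀ p ∈ {b : Site P.d × Fin P.d | SideTouches (Ω j) b.1 b.2},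
        wt P.L η j * ‖covDerivFwd η (1 : Site P.d → Fin P.d → 𝔸ˣ) p.2 (g f) p.1‖ ≤ BG * r)
    (hGsupp : ∀ (f : Site P.d → 𝔸) (x : Site P.d), x ∉ Ω 0 → g f x = 0)
    (hGreal : ∀ f : Site P.d → 𝔸, (∀ j, j ≤ 1 → ∀ x ∈ Ω j, IsSelfAdjoint (f x)) → ∀ x, IsSelfAdjoint (g f x))
    (hRbd : ∀ (f : Site P.d → 𝔸) (r : ℝ), 0 ≤ r → Bd2 P.L η 1 Ω f r → Bd2 P.L η 1 Ω (f - g (qs (c (q (g f))))) (BR * r))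
    (hRreal : ∀ f : Site P.d → 𝔸, (∀ j, j ≤ 1 → ∀ x ∈ Ω j, IsSelfAdjoint (f x)) →
      ∀ j, j ≤ 1 → ∀ x ∈ Ω j, IsSelfAdjoint ((f - g (qs (c (q (g f))))) x))
    -- the family constants of the top step (no lower family at the base: only nonnegativity) and their windows
    {Cb Cl : ℝ} (hCb : 0 ≤ Cb) (hCl : 0 ≤ Cl) (hCbρ : Cb ≤ α₄ / (2 * B₀'H)) (hClB : Cl * B₀'H ≤ 1 / 2)
    -- (D) the torus side: the effective-gauge tower of the charted iterate, the representative, the target (✓p636261's letters VERBATIM at `k := 1`)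
    (W₁ : GaugeField P 0 𝔸ˣ) (κf : (Literature.MathematicalPhysics.QuantumFieldTheory.Balaban1983to89.Site P 0 → 𝔸) → (i : ℕ) → GaugeTransf P i 𝔸ˣ)
    (rep : Literature.MathematicalPhysics.QuantumFieldTheory.Balaban1983to89.Site P 0 → Site P.d)
    (hrep : ∀ yc ∈ Λs1 1, ∀ x : Site P.d, InBox (tlo P.L yc 1) (thi P.L yc 1) x → rep (cover P x) = x)
    (y₀ : Literature.MathematicalPhysics.QuantumFieldTheory.Balaban1983to89.Site P 1)
    (th : XSpace P.d 1 𝔸) (hτ : B₀'H * ‖th‖ < α₄ / 4) (hth : ∀ p, star (th p) = -th p)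
    (hthk : ∀ yc ∈ Λs1 1, th (⟨1, Nat.lt_succ_self 1⟩, yc) = mlog ((axialT (dbarIterU 1 W₁) y₀ (coverAt P 1 yc) : 𝔸ˣ) : 𝔸))
    (hthlo : ∀ (j : ℕ) (hj : j < 1) (y : Site P.d), y ∈ Λs1 j → th (⟨j, Nat.lt_succ_of_lt hj⟩, y) = 0)
    (haxT : ∀ yc ∈ Λs1 1, ‖((axialT (dbarIterU 1 W₁) y₀ (coverAt P 1 yc) : 𝔸ˣ) : 𝔸) - 1‖ < 1)
    -- the top-step windows at the Sect. E sizes (✓p636261's letters VERBATIM, `B₀' := B₀'H`)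
    (ha₁' : α₄ / 4 + B₀'H * (Cb + ‖th‖) ≤ 1 / 24) (hb₁' : α₄ / 4 + B₀'H * (Cb + ‖th‖) ≤ 1 / 140)
    (hθ : 10 * (α₄ / 4 + B₀'H * (Cb + ‖th‖)) * BR ≤ 1 / 2) (hh₀' : B₀'H * (Cb + ‖th‖) ≤ 3 * α₄ / 4)
    (h103 : BG * Mc P.d BR (α₄ / 4 + B₀'H * (Cb + ‖th‖)) cA (B₂' * (Cb + ‖th‖)) cDA ≤ α₄ / 4)
    (h106 : BG * Kc P.d BR (α₄ / 4 + B₀'H * (Cb + ‖th‖)) cA (B₂' * (Cb + ‖th‖)) cDA (B₂' * (2 * Cl)) (1 + B₀'H * (2 * Cl)) (1 + B₀'H * (2 * Cl))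
      ≤ 1 / 2)
    -- (E) the three top rows in torus letters on the tower box (✓p636261's letters VERBATIM at `k := 1`)
    (hTop121 : ∀ yc ∈ Λs1 1, ∀ l₀ : Literature.MathematicalPhysics.QuantumFieldTheory.Balaban1983to89.Site P 0 → 𝔸,
      (∀ x : Site P.d, InBox (tlo P.L yc 1) (thi P.L yc 1) x → ‖l₀ (cover P x)‖ ≤ α₄) →
      (∀ (x : Site P.d) (κ : Fin P.d), InBox (tlo P.L yc 1) (thi P.L yc 1) x → InBox (tlo P.L yc 1) (thi P.L yc 1) (x + e κ) →
        ‖l₀ (cover P (x + e κ)) - l₀ (cover P x)‖ ≤ α₄ * ((P.L : ℝ) ^ 1)⁻¹) →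
      exp (mlog ((κf l₀ 1 (coverAt P 1 yc) : 𝔸ˣ) : 𝔸)) = ((κf l₀ 1 (coverAt P 1 yc) : 𝔸ˣ) : 𝔸) ∧
        ‖mlog ((κf l₀ 1 (coverAt P 1 yc) : 𝔸ˣ) : 𝔸) - siteAvgIter 1 l₀ (coverAt P 1 yc)‖ ≤ Cb)
    (hTop125 : ∀ yc ∈ Λs1 1, ∀ (l₁ l₂ : Literature.MathematicalPhysics.QuantumFieldTheory.Balaban1983to89.Site P 0 → 𝔸) (r : ℝ), 0 ≤ r →
      (∀ x : Site P.d, InBox (tlo P.L yc 1) (thi P.L yc 1) x → ‖l₁ (cover P x)‖ ≤ α₄) →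
      (∀ (x : Site P.d) (κ : Fin P.d), InBox (tlo P.L yc 1) (thi P.L yc 1) x → InBox (tlo P.L yc 1) (thi P.L yc 1) (x + e κ) →
        ‖l₁ (cover P (x + e κ)) - l₁ (cover P x)‖ ≤ α₄ * ((P.L : ℝ) ^ 1)⁻¹) →
      (∀ x : Site P.d, InBox (tlo P.L yc 1) (thi P.L yc 1) x → ‖l₂ (cover P x)‖ ≤ α₄) →
      (∀ (x : Site P.d) (κ : Fin P.d), InBox (tlo P.L yc 1) (thi P.L yc 1) x → InBox (tlo P.L yc 1) (thi P.L yc 1) (x + e κ) →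
        ‖l₂ (cover P (x + e κ)) - l₂ (cover P x)‖ ≤ α₄ * ((P.L : ℝ) ^ 1)⁻¹) →
      (∀ x : Site P.d, InBox (tlo P.L yc 1) (thi P.L yc 1) x → ‖l₁ (cover P x) - l₂ (cover P x)‖ ≤ r) →
      (∀ (x : Site P.d) (κ : Fin P.d), InBox (tlo P.L yc 1) (thi P.L yc 1) x → InBox (tlo P.L yc 1) (thi P.L yc 1) (x + e κ) →
        ‖(l₁ (cover P (x + e κ)) - l₂ (cover P (x + e κ))) - (l₁ (cover P x) - l₂ (cover P x))‖ ≤ r * ((P.L : ℝ) ^ 1)⁻¹) →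
      ‖(mlog ((κf l₁ 1 (coverAt P 1 yc) : 𝔸ˣ) : 𝔸) - siteAvgIter 1 l₁ (coverAt P 1 yc)) -
          (mlog ((κf l₂ 1 (coverAt P 1 yc) : 𝔸ˣ) : 𝔸) - siteAvgIter 1 l₂ (coverAt P 1 yc))‖ ≤ Cl * r)
    (hTopReal : ∀ yc ∈ Λs1 1, ∀ l₀ : Literature.MathematicalPhysics.QuantumFieldTheory.Balaban1983to89.Site P 0 → 𝔸,
      (∀ x : Site P.d, InBox (tlo P.L yc 1) (thi P.L yc 1) x → ‖l₀ (cover P x)‖ ≤ α₄) →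
      (∀ (x : Site P.d) (κ : Fin P.d), InBox (tlo P.L yc 1) (thi P.L yc 1) x → InBox (tlo P.L yc 1) (thi P.L yc 1) (x + e κ) →
        ‖l₀ (cover P (x + e κ)) - l₀ (cover P x)‖ ≤ α₄ * ((P.L : ℝ) ^ 1)⁻¹) →
      mlog ((κf (fun s => -star (l₀ s)) 1 (coverAt P 1 yc) : 𝔸ˣ) : 𝔸) - siteAvgIter 1 (fun s => -star (l₀ s)) (coverAt P 1 yc) =
        -star (mlog ((κf l₀ 1 (coverAt P 1 yc) : 𝔸ˣ) : 𝔸) - siteAvgIter 1 l₀ (coverAt P 1 yc))) :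
    ∃ lam : Site P.d → 𝔸, (∀ x, IsSelfAdjoint (lam x)) ∧ (∀ x, x ∉ Ω 0 → lam x = 0) ∧
      (∀ j, j ≤ 1 → ∀ b ∈ {b : Site P.d × Fin P.d | SideTouches (Ω j) b.1 b.2},
        ‖lam b.1‖ ≤ α₄ ∧ wt P.L η j * ‖covDerivFwd η (1 : Site P.d → Fin P.d → 𝔸ˣ) b.2 lam b.1‖ ≤ α₄) ∧
      (∃ μ : ℕ → Site P.d → 𝔸, ∀ x ∈ Ω 0,
        covLap η (1 : Site P.d → Fin P.d → 𝔸ˣ) ((Ω 0).indicator fun y =>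
          covDivB η (1 : Site P.d → Fin P.d → 𝔸ˣ) A y + covLap η (1 : Site P.d → Fin P.d → 𝔸ˣ) lam y +
          ((conjR (gaugeExp lam y)⁻¹ (covDivB η (1 : Site P.d → Fin P.d → 𝔸ˣ) A y) - covDivB η (1 : Site P.d → Fin P.d → 𝔸ˣ) A y) +
            (gAd (covLap η (1 : Site P.d → Fin P.d → 𝔸ˣ) lam y) (lam y) - covLap η (1 : Site P.d → Fin P.d → 𝔸ˣ) lam y) +
            ∑ μ, frakF3 η (1 : Site P.d → Fin P.d → 𝔸ˣ) lam A y μ)) x = QT P.L 1 Λs1 (1 : Site P.d → Fin P.d → 𝔸ˣ) μ x) ∧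
      (∀ j, j < 1 → ∀ y ∈ Λs1 j,
        Qnl P.L (1 : Site P.d → Fin P.d → 𝔸ˣ) (fun x => expUnit (((-I) • lam) x)) (1 : Site P.d → 𝔸ˣ) j y = 0) ∧
      (∀ yc ∈ Λs1 1, κf (((-I) • lam) ∘ rep) 1 (coverAt P 1 yc) = axialT (dbarIterU 1 W₁) y₀ (coverAt P 1 yc)) ∧
      (∀ x ∈ Ω 0, ∀ μ : Fin P.d,
        wt P.L η 0 * ‖A x μ‖ ≤ cA ∧ wt P.L η 0 * ‖conjR ((1 : Site P.d → Fin P.d → 𝔸ˣ) (x - e μ) μ)⁻¹ (A (x - e μ) μ)‖ ≤ cA) := by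
  have hU₀ : ∀ (x : Site P.d) (κ : Fin P.d), (1 : Site P.d → Fin P.d → 𝔸ˣ) x κ ∈ unitaryUnits 𝔸 := fun _ _ => (unitaryUnits 𝔸).one_mem
  have hL1 : 1 ≤ P.L := le_trans (by norm_num) hL
  have hLr : (1 : ℝ) ≤ P.L := by exact_mod_cast hL1
  have hcA0 : 0 ≤ cA := le_trans (by positivity) hcAw
  have hcDA0 : 0 ≤ cDA := le_trans (by positivity) hcDAw
  have hα₄5 : α₄ ≤ 1 / 5 := by
    have h : 0 ≤ B₀'H * (Cb + ‖th‖) := mul_nonneg hB₀'H.le (add_nonneg hCb (norm_nonneg _))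
    linarith
  -- `Ω j ⊆ Ω 0` for `j ≤ 1`
  have hΩ0 : ∀ j, j ≤ 1 → ∀ x ∈ Ω j, x ∈ Ω 0 := by
    intro j hj x hx
    rcases Nat.le_one_iff_eq_zero_or_eq_one.1 hj with rfl | rfl
    · exact hx
    · exact hΩ 0 hx
  -- the weights at levels `j ≤ 1`: `0 ≤ Lʲη ≤ Lη`
  have hwt : ∀ j, j ≤ 1 → 0 ≤ wt P.L η j ∧ wt P.L η j ≤ (P.L : ℝ) * η := by
    intro j hj
    refine ⟨by unfold wt; positivity, ?_⟩
    unfold wt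
    have h : (P.L : ℝ) ^ j ≤ (P.L : ℝ) ^ 1 := pow_le_pow_right₀ hLr hj
    rw [pow_one] at h
    exact mul_le_mul_of_nonneg_right h hη.le
  -- the pointwise sizes `‖A‖ ≤ 2s·η⁻¹` on both bonds at every `x ∈ Ω₀`
  have hbond : ∀ x ∈ Ω 0, ∀ μ : Fin P.d, ‖A x μ‖ ≤ 2 * s * η⁻¹ ∧ ‖A (x - e μ) μ‖ ≤ 2 * s * η⁻¹ := by
    intro x hx μ
    obtain ⟨⟨-, h1⟩, -, h2⟩ := hArows x hx μ
    rw [le_mul_inv_iff₀ hη, mul_comm, le_mul_inv_iff₀ hη, mul_comm (‖A (x - e μ) μ‖)]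
    exact ⟨h1, h2⟩
  have hLs : ((P.L : ℝ) * η) * (2 * s * η⁻¹) = (P.L : ℝ) * (2 * s) := by field_simp
  -- ✓p636261's `hA` at levels `j ≤ 1`: `Lʲη·‖A‖ ≤ Lη·2sη⁻¹ = L·2s ≤ cA` (and `R(1)⁻¹ = id` on the backward bond)
  have hA' : ∀ j, j ≤ 1 → ∀ x ∈ Ω j, ∀ μ : Fin P.d,
      wt P.L η j * ‖A x μ‖ ≤ cA ∧ wt P.L η j * ‖conjR ((1 : Site P.d → Fin P.d → 𝔸ˣ) (x - e μ) μ)⁻¹ (A (x - e μ) μ)‖ ≤ cA := by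
    intro j hj x hx μ
    obtain ⟨hw0, hwL⟩ := hwt j hj
    obtain ⟨h1, h2⟩ := hbond x (hΩ0 j hj x hx) μ
    rw [Pi.one_apply, Pi.one_apply, conjR_unitOne_inv]
    constructor
    · calc wt P.L η j * ‖A x μ‖ ≤ ((P.L : ℝ) * η) * (2 * s * η⁻¹) := mul_le_mul hwL h1 (norm_nonneg _) (by positivity)
        _ ≤ cA := by rw [hLs]; exact hcAw
    · calc wt P.L η j * ‖A (x - e μ) μ‖ ≤ ((P.L : ℝ) * η) * (2 * s * η⁻¹) := mul_le_mul hwL h2 (norm_nonneg _) (by positivity)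
        _ ≤ cA := by rw [hLs]; exact hcAw
  -- ✓p636261's `hDA` at levels `j ≤ 1`: `‖D*_1 A(x)‖ ≤ Σ_μ η⁻¹(‖A(x − e_μ)‖ + ‖A x‖) ≤ 4d·s·η⁻²`, `(Lʲη)²·that ≤ 4dL²s ≤ cDA`
  have hdiv : ∀ x ∈ Ω 0, ‖covDivB η (1 : Site P.d → Fin P.d → 𝔸ˣ) A x‖ ≤ (P.d : ℝ) * (η⁻¹ * (4 * s * η⁻¹)) := by
    intro x hx
    rw [covDivB]
    refine (norm_sum_le _ _).trans ?_
    have hterm : ∀ μ ∈ (Finset.univ : Finset (Fin P.d)), ‖covDeriv η (1 : Site P.d → Fin P.d → 𝔸ˣ) μ (fun z => A z μ) x‖ ≤ η⁻¹ * (4 * s * η⁻¹) := by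
      intro μ _
      obtain ⟨h1, h2⟩ := hbond x hx μ
      rw [covDeriv, Pi.one_apply, Pi.one_apply, conjR_unitOne_inv, norm_smul, norm_inv, Real.norm_eq_abs, abs_of_pos hη]
      refine mul_le_mul_of_nonneg_left ((norm_sub_le _ _).trans ?_) (inv_nonneg.2 hη.le)
      linarith
    refine (Finset.sum_le_sum hterm).trans ?_
    rw [Finset.sum_const, Finset.card_univ, Fintype.card_fin, nsmul_eq_mul]
  have hDA : Bd2 P.L η 1 Ω (fun y => covDivB η (1 : Site P.d → Fin P.d → 𝔸ˣ) A y) cDA := by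
    intro j hj x hx
    obtain ⟨hw0, hwL⟩ := hwt j hj
    have hd := hdiv x (hΩ0 j hj x hx)
    have hw2 : wt P.L η j ^ 2 ≤ ((P.L : ℝ) * η) ^ 2 := pow_le_pow_left₀ hw0 hwL 2
    calc wt P.L η j ^ 2 * ‖covDivB η (1 : Site P.d → Fin P.d → 𝔸ˣ) A x‖
        ≤ ((P.L : ℝ) * η) ^ 2 * ((P.d : ℝ) * (η⁻¹ * (4 * s * η⁻¹))) := mul_le_mul hw2 hd (norm_nonneg _) (by positivity)
      _ = 4 * (P.d : ℝ) * (P.L : ℝ) ^ 2 * s := by field_simp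
      _ ≤ cDA := hcDAw
  have hDAsa : ∀ j, j ≤ 1 → ∀ x ∈ Ω j, IsSelfAdjoint (covDivB η (1 : Site P.d → Fin P.d → 𝔸ˣ) A x) :=
    fun j _ x _ => isSelfAdjoint_covDivB hU₀ hAsa x
  -- the JOIN's bond classes `Eb j := {b ∣ SideTouches (Ω j) b}`
  have hEbΩ : ∀ j, j ≤ 1 → ∀ x ∈ Ω j, ∀ μ : Fin P.d, (x, μ) ∈ {b : Site P.d × Fin P.d | SideTouches (Ω j) b.1 b.2} ∧
      (x - e μ, μ) ∈ {b : Site P.d × Fin P.d | SideTouches (Ω j) b.1 b.2} := fun j _ x hx μ => sideTouches_pair_of_mem hd2 hx μ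
  have hEbT : ∀ j, j ≤ 1 → ∀ y ∈ Λs1 j, ∀ (x : Site P.d) (κ : Fin P.d), InBox (tlo P.L y j) (thi P.L y j) x →
      InBox (tlo P.L y j) (thi P.L y j) (x + e κ) → (x, κ) ∈ {b : Site P.d × Fin P.d | SideTouches (Ω j) b.1 b.2} :=
    fun j hj y hy x κ hx _ => sideTouches_of_tower_bond hd2 htower hj hy x κ hx
  -- the (C) rows below the top: only `j = 0`, where `C′₀ ≡ 0` (§1)
  have hC0 : ∀ j, j < 1 → ∀ y ∈ Λs1 j, ∀ μ : Site P.d → 𝔸, (∀ x : Site P.d, InBox (tlo P.L y j) (thi P.L y j) x → ‖μ x‖ < α₄) →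
      Cnl P.L (1 : Site P.d → Fin P.d → 𝔸ˣ) (1 : Site P.d → 𝔸ˣ)⁻¹ j μ y = 0 := by
    intro j hj y _ μ hb
    have hj0 : j = 0 := by omega
    subst hj0
    have hμ : ‖μ y‖ ≤ 1 / 5 := ((hb y (inBox_tlo_thi_zero_self P.L y)).le.trans hα₄5)
    exact Cnl_level_zero P.L _ _ μ y hμ
  have hC121lo : ∀ j, j < 1 → ∀ y ∈ Λs1 j, ∀ μ : Site P.d → 𝔸,
      (∀ x : Site P.d, InBox (tlo P.L y j) (thi P.L y j) x → ‖μ x‖ < α₄) →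
      (∀ (x : Site P.d) (κ : Fin P.d), InBox (tlo P.L y j) (thi P.L y j) x → InBox (tlo P.L y j) (thi P.L y j) (x + e κ) →
        ‖cj ((1 : Site P.d → Fin P.d → 𝔸ˣ) x κ) (μ (x + e κ)) - μ x‖ < α₄ * ((P.L : ℝ) ^ j)⁻¹) →
      ‖Cnl P.L (1 : Site P.d → Fin P.d → 𝔸ˣ) (1 : Site P.d → 𝔸ˣ)⁻¹ j μ y‖ ≤ Cb := by
    intro j hj y hy μ hb _
    rw [hC0 j hj y hy μ hb, norm_zero]; exact hCb
  have hC125lo : ∀ j, j < 1 → ∀ y ∈ Λs1 j, ∀ (μ₁ μ₂ : Site P.d → 𝔸) (r : ℝ), 0 ≤ r →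
      (∀ x : Site P.d, InBox (tlo P.L y j) (thi P.L y j) x → ‖μ₁ x‖ < α₄) →
      (∀ (x : Site P.d) (κ : Fin P.d), InBox (tlo P.L y j) (thi P.L y j) x → InBox (tlo P.L y j) (thi P.L y j) (x + e κ) →
        ‖cj ((1 : Site P.d → Fin P.d → 𝔸ˣ) x κ) (μ₁ (x + e κ)) - μ₁ x‖ < α₄ * ((P.L : ℝ) ^ j)⁻¹) →
      (∀ x : Site P.d, InBox (tlo P.L y j) (thi P.L y j) x → ‖μ₂ x‖ < α₄) →
      (∀ (x : Site P.d) (κ : Fin P.d), InBox (tlo P.L y j) (thi P.L y j) x → InBox (tlo P.L y j) (thi P.L y j) (x + e κ) →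
        ‖cj ((1 : Site P.d → Fin P.d → 𝔸ˣ) x κ) (μ₂ (x + e κ)) - μ₂ x‖ < α₄ * ((P.L : ℝ) ^ j)⁻¹) →
      (∀ x : Site P.d, InBox (tlo P.L y j) (thi P.L y j) x → ‖(μ₁ - μ₂) x‖ ≤ r) →
      (∀ (x : Site P.d) (κ : Fin P.d), InBox (tlo P.L y j) (thi P.L y j) x → InBox (tlo P.L y j) (thi P.L y j) (x + e κ) →
        ‖cj ((1 : Site P.d → Fin P.d → 𝔸ˣ) x κ) ((μ₁ - μ₂) (x + e κ)) - (μ₁ - μ₂) x‖ ≤ r * ((P.L : ℝ) ^ j)⁻¹) →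
      ‖Cnl P.L (1 : Site P.d → Fin P.d → 𝔸ˣ) (1 : Site P.d → 𝔸ˣ)⁻¹ j μ₁ y - Cnl P.L (1 : Site P.d → Fin P.d → 𝔸ˣ) (1 : Site P.d → 𝔸ˣ)⁻¹ j μ₂ y‖ ≤ Cl * r := by
    intro j hj y hy μ₁ μ₂ r hr h1b _ h2b _ _ _
    rw [hC0 j hj y hy μ₁ h1b, hC0 j hj y hy μ₂ h2b, sub_self, norm_zero]; positivity
  have hCreallo : ∀ j, j < 1 → ∀ y ∈ Λs1 j, ∀ μ : Site P.d → 𝔸,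
      (∀ x : Site P.d, InBox (tlo P.L y j) (thi P.L y j) x → ‖μ x‖ < α₄) →
      (∀ (x : Site P.d) (κ : Fin P.d), InBox (tlo P.L y j) (thi P.L y j) x → InBox (tlo P.L y j) (thi P.L y j) (x + e κ) →
        ‖cj ((1 : Site P.d → Fin P.d → 𝔸ˣ) x κ) (μ (x + e κ)) - μ x‖ < α₄ * ((P.L : ℝ) ^ j)⁻¹) →
      Cnl P.L (1 : Site P.d → Fin P.d → 𝔸ˣ) (1 : Site P.d → 𝔸ˣ)⁻¹ j (fun x => -star (μ x)) y =
        -star (Cnl P.L (1 : Site P.d → Fin P.d → 𝔸ˣ) (1 : Site P.d → 𝔸ˣ)⁻¹ j μ y) := by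
    intro j hj y hy μ hb _
    have hb' : ∀ x : Site P.d, InBox (tlo P.L y j) (thi P.L y j) x → ‖-star (μ x)‖ < α₄ := fun x hx => by
      rw [norm_neg, norm_star]; exact hb x hx
    rw [hC0 j hj y hy μ hb, hC0 j hj y hy (fun x => -star (μ x)) hb', star_zero, neg_zero]
  -- THE TOP STEP (✓p636261, BY NAME) at `k := 1`, `Λs := Λs1`, `u₁ := 1`
  obtain ⟨lam, hlsa, hloff, h108, ⟨μ, hmul⟩, hlo, htopId⟩ := hFP_kLevel_top_RD (P := P) (k := 1) (Λs := Λs1)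
    (Eb := fun j => {b : Site P.d × Fin P.d | SideTouches (Ω j) b.1 b.2}) (A := A) h1P hη hEbΩ hEbT g Δ q qs Aw c g_rightΩ c_range hΔ hqs H'
    hα₄ hB₀'H hB₂' hCb hCl hH0 hH1 hH2 hHsupp hHequiv hCbρ hClB hBG hBR hcA0 hcA' hcDA0 hG hGsupp hGreal hRbd hRreal hDA hDAsa hA' hAsa hQH hq
    (1 : Site P.d → 𝔸ˣ) hC121lo hC125lo hCreallo
    W₁ κf rep hrep y₀ th hτ hth hthk hthlo haxT ha₁' hb₁' hθ hh₀' h103 h106 hTop121 hTop125 hTopReal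
  refine ⟨lam, hlsa, hloff, fun j hj b hb => h108 j hj b hb, ⟨μ, hmul⟩, fun j hj y hy => ?_, htopId, fun x hx μ' => hA' 0 (Nat.zero_le _) x hx μ'⟩
  have h := hlo j hj y hy
  rwa [inv_one] at h

end Summit.QuantumFields.YangMills.Theorems.HalvingP1FlatCoreSupplierTopCallBase

end
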